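import Literature.Geometry.Lorentzian.DecaySymbols
import Literature.Geometry.Lorentzian.MassCapacity
import Literature.Geometry.Lorentzian.PositiveMassRigidity
import HarnessLib

/-!
# Asymptotics of a conformal factor: `ψ − 1 = O(1/r)` when `ψ⁴ ds²` and `ds²` are asymptotically
# Schwarzschildean

In Lemma 3.3 and in the proof of Thm. 2 of Schoen–Yau (Comm. Math. Phys. 65 (1979), pp. 71–74) the
conformal factors `φ = 1 + v`, `v = O(1/r)`, are exactly those for which `φ⁴ ds²` has again the
expansion (1.1) (of mass `M + 2A`). Conversely — which is what the uniqueness assertion of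
Lemma 3.2 consumes, and what the steps `hc`/`hd` of `RicciVariationEllipticSteps.lean` record
about the competitors — if `ds²` is asymptotically Schwarzschildean of mass `0` and `ψ⁴ ds²` of
some mass `m` (order `0` suffices), with `ψ > 0`, then `ψ − 1 = O(1/r)` in the chart of the end:

* `AFEnd.hCoeff_eq_smul_of_conformal` — `hCoeff e D'' = (ψ ∘ Φ)⁴ • hCoeff e D` far out for any
  data `D''` whose metric is `ψ⁴ h` pointwise;
* `AFEnd.isBigO_endValue_pow_four_sub_one` — `ψ(Φ z)⁴ − 1 = O(‖z‖⁻¹)`;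
* `AFEnd.isBigO_endValue_sub_one` — `ψ(Φ z) − 1 = O(‖z‖⁻¹)` (`|ψ − 1| ≤ |ψ⁴ − 1|` for
  `ψ ≥ 0`);
* `AFEnd.isBigO_endValue_sub_of_conformal` — two such factors differ by `O(‖z‖⁻¹)`.

All results are proved; no definitions, no named facts.

## References

* R. Schoen, S.-T. Yau, Comm. Math. Phys. 65 (1979) 45–76, §1 (1.1), Lemma 3.2 (p. 64),
  Lemma 3.3 (pp. 71–72).
-/

noncomputable section

set_option maxSynthPendingDepth 3

open Set Function Filter Metric Bornology Asymptotics TopologicalSpace Manifold Bundle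
open scoped Topology Manifold ContDiff

namespace Literature.Geometry.Lorentzian

namespace AFEnd

variable {X : Type} [TopologicalSpace X] [ChartedSpace E3 X] [IsManifold (𝓡 3) ∞ X]
  (e : AFEnd X) {D D'' : InitialDataSet (𝓡 3) X} {ψ : X → ℝ}

/-- **The chart components of a conformal metric**: if the metric of `D''` is `ψ⁴ h` pointwise,
then `hCoeff e D'' z = ψ(Φ z)⁴ • hCoeff e D z` for `R < ‖z‖` (both are pullbacks along the same
inverse chart). [folklore] -/
theorem hCoeff_eq_smul_of_conformal
    (hconf : ∀ (x : X) (v w : TangentSpace (𝓡 3) x),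
      D''.metric.val x v w = ψ x ^ 4 * D.metric.val x v w) {z : E3} (hz : e.R < ‖z‖) :
    hCoeff e D'' z = endValue e ψ z ^ 4 • hCoeff e D z := by
  rw [hCoeff_of_lt D'' hz, hCoeff_of_lt D hz, endValue_of_lt e ψ hz]
  ext v w
  exact hconf _ _ _

/-- Evaluation at a fixed pair of vectors is bounded by the operator norm: a bilinear-form-valued
`O`-estimate gives the same estimate for each component. [folklore] -/
private theorem isBigO_apply₂_of_isBigO_norm {f : E3 → E3 →L[ℝ] E3 →L[ℝ] ℝ} {g : E3 → ℝ}
    (h : (fun z ↦ ‖f z‖) =O[cobounded E3] g) (u v : E3) :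
    (fun z ↦ f z u v) =O[cobounded E3] g := by
  refine IsBigO.trans ?_ h
  refine IsBigO.of_bound (‖u‖ * ‖v‖) (Eventually.of_forall fun z ↦ ?_)
  rw [Real.norm_eq_abs, norm_norm]
  calc |f z u v| = ‖f z u v‖ := (Real.norm_eq_abs _).symm
    _ ≤ ‖f z u‖ * ‖v‖ := (f z u).le_opNorm v
    _ ≤ ‖f z‖ * ‖u‖ * ‖v‖ := mul_le_mul_of_nonneg_right ((f z).le_opNorm u) (norm_nonneg _)
    _ = ‖u‖ * ‖v‖ * ‖f z‖ := by ring

/-- **`ψ⁴ − 1 = O(1/r)`**: if `h` is asymptotically Schwarzschildean of mass `0` and `ψ⁴ h` (the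
metric of `D''`) of mass `m`, both to order `nh, nh' ≥ 0`, then `ψ(Φ z)⁴ − 1 = O(‖z‖⁻¹)`. With a
unit vector `u`: `a = h(u,u) ∘ Φ = 1 + O(r⁻²)`, `ψ⁴ a = (1 + m/(2r))⁴ + O(r⁻²)` and
`(1 + m/(2r))⁴ = 1 + O(r⁻¹)`. [cite: SchoenYauPMT1979, §1 (1.1) and Lemma 3.3] -/
theorem isBigO_endValue_pow_four_sub_one {m : ℝ} {nh nh' : ℕ}
    (hD : IsAsymptoticallySchwarzschild e D 0 nh) (hD'' : IsAsymptoticallySchwarzschild e D'' m nh')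
    (hconf : ∀ (x : X) (v w : TangentSpace (𝓡 3) x),
      D''.metric.val x v w = ψ x ^ 4 * D.metric.val x v w) :
    (fun z ↦ endValue e ψ z ^ 4 - 1) =O[cobounded E3] fun z ↦ ‖z‖⁻¹ := by
  set u : E3 := EuclideanSpace.single (0 : Fin 3) (1 : ℝ) with hu
  have hu1 : ‖u‖ = 1 := by simp [hu]
  have hδu : (innerSL ℝ : E3 →L[ℝ] E3 →L[ℝ] ℝ) u u = 1 := by
    rw [innerSL_apply_apply, real_inner_self_eq_norm_sq, hu1, one_pow]
  set a : E3 → ℝ := fun z ↦ hCoeff e D z u u with ha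
  set a'' : E3 → ℝ := fun z ↦ hCoeff e D'' z u u with ha''
  set P : E3 → ℝ := fun z ↦ (1 + m / (2 * ‖z‖)) ^ 4 with hP
  -- (1) `a − 1 = O(r⁻²)` and `a'' − P = O(r⁻²)`
  have hr2 : (fun z : E3 ↦ ‖z‖ ^ (-2 - (0 : ℕ) : ℝ)) =O[cobounded E3] fun z ↦ ‖z‖⁻¹ := by
    simp only [Nat.cast_zero, sub_zero]
    have h := isBigO_norm_rpow_rpow_cobounded (E := E3) (by norm_num : (-2 : ℝ) ≤ -1)
    refine h.trans (IsBigO.of_bound 1 (Eventually.of_forall fun z ↦ ?_))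
    rw [Real.rpow_neg_one, one_mul]
  have h1 : (fun z ↦ a z - 1) =O[cobounded E3] fun z ↦ ‖z‖⁻¹ := by
    have h0 := hD 0 (Nat.zero_le _)
    simp only [norm_iteratedFDeriv_zero, zero_div, add_zero, one_pow, one_smul] at h0
    have hc := isBigO_apply₂_of_isBigO_norm h0 u u
    refine (hc.congr_left fun z ↦ ?_).trans hr2
    simp only [ha, _root_.sub_apply, hδu]
  have h2 : (fun z ↦ a'' z - P z) =O[cobounded E3] fun z ↦ ‖z‖⁻¹ := by
    have h0 := hD'' 0 (Nat.zero_le _)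
    simp only [norm_iteratedFDeriv_zero] at h0
    have hc := isBigO_apply₂_of_isBigO_norm h0 u u
    refine (hc.congr_left fun z ↦ ?_).trans hr2
    simp only [ha'', hP, _root_.sub_apply, FunLike.coe_smul, Pi.smul_apply,
      smul_eq_mul, hδu, mul_one]
  -- (2) `P − 1 = O(r⁻¹)`
  have h3 : (fun z ↦ P z - 1) =O[cobounded E3] fun z ↦ ‖z‖⁻¹ := by
    have hsym := IsBigOSmooth.add_pow_four_sub_pow_four (E := E3) (k := 2) (a := -1)
      (isBigOSmooth_const 2 (1 : ℝ))
      ((isBigOSmooth_inv_norm (E := E3)).const_mul (m / 2)) (by norm_num)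
    have h0 := hsym.isBigO (m := 0) (Nat.zero_le _)
    simp only [norm_iteratedFDeriv_zero, Nat.cast_zero, sub_zero, one_pow] at h0
    have h0' : (fun z : E3 ↦ (1 + m / 2 * ‖z‖⁻¹) ^ 4 - 1) =O[cobounded E3] fun z ↦ ‖z‖⁻¹ := by
      refine (h0.of_norm_left).trans (IsBigO.of_bound 1 (Eventually.of_forall fun z ↦ ?_))
      rw [Real.rpow_neg_one, one_mul]
    refine h0'.congr_left fun z ↦ ?_
    simp only [hP]
    congr 2
    rw [div_mul_eq_mul_div, mul_comm, ← div_div, div_eq_mul_inv (m / 2)]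
    ring
  -- (3) `a → 1`, so `a⁻¹` is eventually bounded by `2` and `a ≠ 0`
  have ha_tend : Tendsto a (cobounded E3) (𝓝 1) := by
    have ht : Tendsto (fun z ↦ a z - 1) (cobounded E3) (𝓝 0) :=
      h1.trans_tendsto (tendsto_inv_atTop_zero.comp tendsto_norm_cobounded_atTop)
    have := ht.add_const 1
    simpa using this
  have ha_inv : (fun z ↦ (a z)⁻¹) =O[cobounded E3] fun _ ↦ (1 : ℝ) := by
    refine IsBigO.of_bound 2 ?_
    filter_upwards [ha_tend.eventually (lt_mem_nhds (by norm_num : (1 / 2 : ℝ) < 1))] with z hz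
    have hapos : 0 < a z := lt_trans (by norm_num) hz
    rw [norm_inv, Real.norm_of_nonneg hapos.le, norm_one, mul_one]
    rw [inv_le_comm₀ hapos two_pos]
    linarith
  have ha_ne : ∀ᶠ z in cobounded E3, a z ≠ 0 := by
    filter_upwards [ha_tend.eventually (lt_mem_nhds (by norm_num : (1 / 2 : ℝ) < 1))] with z hz
    exact (lt_trans (by norm_num) hz).ne'
  -- (4) far out, `ψ⁴ a = a''`, hence `ψ⁴ − 1 = ((a'' − P) + (P − 1) + (1 − a)) a⁻¹`
  have hfar : ∀ᶠ z in cobounded E3, endValue e ψ z ^ 4 - 1 =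
      ((a'' z - P z) + (P z - 1) + -(a z - 1)) * (a z)⁻¹ := by
    filter_upwards [ha_ne, eventually_cobounded_lt_norm e.R] with z hz hzR
    have hprod : a'' z = endValue e ψ z ^ 4 * a z := by
      simp only [ha'', ha]
      rw [e.hCoeff_eq_smul_of_conformal hconf hzR, FunLike.coe_smul, Pi.smul_apply,
        FunLike.coe_smul, Pi.smul_apply, smul_eq_mul]
    field_simp
    rw [hprod]
    ring
  have hsum : (fun z ↦ ((a'' z - P z) + (P z - 1) + -(a z - 1)) * (a z)⁻¹) =O[cobounded E3]
      fun z ↦ ‖z‖⁻¹ := by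
    have h := ((h2.add h3).add h1.neg_left).mul ha_inv
    simpa using h
  exact (hsum.congr' (hfar.mono fun z hz ↦ hz.symm) EventuallyEq.rfl)

/-- **`ψ − 1 = O(1/r)`** for a positive conformal factor between asymptotically Schwarzschildean
metrics (`h` of mass `0`, `ψ⁴ h` of mass `m`): `|ψ − 1| ≤ |ψ⁴ − 1|` for `ψ ≥ 0`
(`ψ⁴ − 1 = (ψ − 1)(ψ³ + ψ² + ψ + 1)`). This is the form `φ = 1 + v`, `v = O(1/r)` in which
Schoen–Yau's Lemma 3.2 (uniqueness) sees the conformal factors of Lemma 3.3.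
[cite: SchoenYauPMT1979, Lemma 3.2 (p. 64) and Lemma 3.3 (pp. 71–72)] -/
theorem isBigO_endValue_sub_one {m : ℝ} {nh nh' : ℕ}
    (hD : IsAsymptoticallySchwarzschild e D 0 nh) (hD'' : IsAsymptoticallySchwarzschild e D'' m nh')
    (hpos : ∀ x, 0 < ψ x)
    (hconf : ∀ (x : X) (v w : TangentSpace (𝓡 3) x),
      D''.metric.val x v w = ψ x ^ 4 * D.metric.val x v w) :
    (fun z ↦ endValue e ψ z - 1) =O[cobounded E3] fun z ↦ ‖z‖⁻¹ := by
  refine IsBigO.trans ?_ (e.isBigO_endValue_pow_four_sub_one hD hD'' hconf)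
  refine IsBigO.of_bound 1 (Eventually.of_forall fun z ↦ ?_)
  have hψ0 : 0 ≤ endValue e ψ z := by
    by_cases hz : e.R < ‖z‖
    · rw [endValue_of_lt e ψ hz]
      exact (hpos _).le
    · rw [endValue_of_not_lt e ψ hz]
  set f := endValue e ψ z with hf
  rw [one_mul, Real.norm_eq_abs, Real.norm_eq_abs,
    show f ^ 4 - 1 = (f - 1) * (f ^ 3 + f ^ 2 + f + 1) by ring, abs_mul]
  have hge : 1 ≤ |f ^ 3 + f ^ 2 + f + 1| := by
    rw [abs_of_nonneg (by positivity)]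
    nlinarith [pow_nonneg hψ0 3, pow_nonneg hψ0 2]
  calc |f - 1| = |f - 1| * 1 := (mul_one _).symm
    _ ≤ |f - 1| * |f ^ 3 + f ^ 2 + f + 1| := mul_le_mul_of_nonneg_left hge (abs_nonneg _)

/-- **Two conformal factors making `h` asymptotically Schwarzschildean differ by `O(1/r)`**:
if `ψ⁴ h` and `φ⁴ h` (the metrics of `D₁, D₂`) are asymptotically Schwarzschildean of masses
`m₁, m₂` and `h` of mass `0`, with `ψ, φ > 0`, then `(ψ − φ)(Φ z) = O(‖z‖⁻¹)` — the decay
hypothesis of the uniqueness theorem `AFEnd.eq_zero_of_dalembertian_eq_mul`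
(`AFLinearUniqueness.lean`) for the difference of two factors.
[cite: SchoenYauPMT1979, Lemma 3.2 (p. 64) and Lemma 3.3 (pp. 71–72)] -/
theorem isBigO_endValue_sub_of_conformal {D₁ D₂ : InitialDataSet (𝓡 3) X} {φ : X → ℝ}
    {m₁ m₂ : ℝ} {nh nh₁ nh₂ : ℕ}
    (hD : IsAsymptoticallySchwarzschild e D 0 nh) (hD₁ : IsAsymptoticallySchwarzschild e D₁ m₁ nh₁)
    (hD₂ : IsAsymptoticallySchwarzschild e D₂ m₂ nh₂) (hψ : ∀ x, 0 < ψ x) (hφ : ∀ x, 0 < φ x)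
    (hconf₁ : ∀ (x : X) (v w : TangentSpace (𝓡 3) x),
      D₁.metric.val x v w = ψ x ^ 4 * D.metric.val x v w)
    (hconf₂ : ∀ (x : X) (v w : TangentSpace (𝓡 3) x),
      D₂.metric.val x v w = φ x ^ 4 * D.metric.val x v w) :
    endValue e (fun x ↦ ψ x - φ x) =O[cobounded E3] fun z ↦ ‖z‖⁻¹ := by
  have h1 := e.isBigO_endValue_sub_one hD hD₁ hψ hconf₁
  have h2 := e.isBigO_endValue_sub_one hD hD₂ hφ hconf₂
  refine (h1.sub h2).congr_left fun z ↦ ?_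
  by_cases hz : e.R < ‖z‖
  · simp only [endValue_of_lt e _ hz]
    ring
  · simp only [endValue_of_not_lt e _ hz]
    ring

end AFEnd

end Literature.Geometry.Lorentzian

end
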